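import Mathlib.Algebra.Polynomial.Roots
import Mathlib.Order.Interval.Set.Infinite
import Summits.KontsevichZagierPeriods.Zeta5Search.Certificates.VIMLevel2K2
import HarnessLib

/-!
# ζ(5) search — brown9 LEVEL 2 (R-K2), all `k₃`: the relation at `x = n` by polynomiality (cell `pub-zeta5`, certifier `cert-1`)

HONEST FRAMING: systematic search; no irrationality claim unless certified.

`Certificates/VIMLevel2K2.lean` proved the lane's relation (R-K2)
`η₀₀(n,x) R(n,x) + η₀₁(n,x) R(n,x+1) + η₀₂(n,x) R(n,x+2) = 0` for every rational `x < n` (`n ≥ 3`); the point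
`x = n` is excluded there because the level-1 reduction degenerates at `p = q`. Here the gap is closed WITHOUT a
further certificate: for fixed `n` the left-hand side is a POLYNOMIAL function of `x` (the inner block `T` uses
polynomial binomials, `h` is a polynomial binomial, the `η` are polynomials) — explicit polynomial representatives
`PolyRep` below, built with `Polynomial.eval_finsetSum` / `eval_prod` — and a polynomial over `ℚ` vanishing on the
infinite set `{x < n}` is zero (`Polynomial.eq_zero_of_infinite_isRoot`).
Result: **`R_rel_K2_all (n ≥ 3) (x : ℚ)`** — (R-K2) for EVERY rational `x`, in particular every integer `k₃`.
No named facts.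
-/

noncomputable section

namespace Summit.KontsevichZagierPeriods.Zeta5Search.Certificates

namespace VIMInner

open Finset Polynomial

/-! ### Polynomial representatives of functions `ℚ → ℚ` -/

/-- A polynomial whose evaluation map is the function `f` (data: the polynomial and the identity). -/
structure PolyRep (f : ℚ → ℚ) where
  /-- the representing polynomial -/
  poly : ℚ[X]
  /-- `f` is its evaluation map -/
  eval_eq : ∀ x, f x = poly.eval x

namespace PolyRep

/-- Constants. -/
def const (c : ℚ) : PolyRep fun _ => c := ⟨C c, fun x => by simp⟩

/-- The identity. -/
def id : PolyRep fun x => x := ⟨X, fun x => by simp⟩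

/-- Sums. -/
def add {f g : ℚ → ℚ} (hf : PolyRep f) (hg : PolyRep g) : PolyRep fun x => f x + g x :=
  ⟨hf.poly + hg.poly, fun x => by simp [hf.eval_eq x, hg.eval_eq x]⟩

/-- Differences. -/
def sub {f g : ℚ → ℚ} (hf : PolyRep f) (hg : PolyRep g) : PolyRep fun x => f x - g x :=
  ⟨hf.poly - hg.poly, fun x => by simp [hf.eval_eq x, hg.eval_eq x]⟩

/-- Products. -/
def mul {f g : ℚ → ℚ} (hf : PolyRep f) (hg : PolyRep g) : PolyRep fun x => f x * g x :=
  ⟨hf.poly * hg.poly, fun x => by simp [hf.eval_eq x, hg.eval_eq x]⟩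

/-- Quotients by constants. -/
def divConst {f : ℚ → ℚ} (hf : PolyRep f) (c : ℚ) : PolyRep fun x => f x / c :=
  ⟨hf.poly * C c⁻¹, fun x => by simp [hf.eval_eq x, div_eq_mul_inv]⟩

/-- Finite sums. -/
def sum {ι : Type*} (s : Finset ι) {f : ι → ℚ → ℚ} (hf : ∀ i, PolyRep (f i)) :
    PolyRep fun x => ∑ i ∈ s, f i x :=
  ⟨∑ i ∈ s, (hf i).poly, fun x => by
    rw [eval_finsetSum]; exact sum_congr rfl fun i _ => (hf i).eval_eq x⟩

/-- Finite products. -/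
def prod {ι : Type*} (s : Finset ι) {f : ι → ℚ → ℚ} (hf : ∀ i, PolyRep (f i)) :
    PolyRep fun x => ∏ i ∈ s, f i x :=
  ⟨∏ i ∈ s, (hf i).poly, fun x => by
    rw [eval_prod]; exact prod_congr rfl fun i _ => (hf i).eval_eq x⟩

/-- A polynomially represented function vanishing on `{x < a}` vanishes everywhere. -/
theorem eq_zero_of_lt {f : ℚ → ℚ} (hf : PolyRep f) (a : ℚ) (h : ∀ x, x < a → f x = 0) (x : ℚ) : f x = 0 := by
  have hroots : Set.Infinite {y : ℚ | IsRoot hf.poly y} := by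
    refine (Set.Iio_infinite a).mono ?_
    intro y hy
    simp only [Set.mem_setOf_eq, IsRoot.def, ← hf.eval_eq y]
    exact h y hy
  have hP0 : hf.poly = 0 := Polynomial.eq_zero_of_infinite_isRoot _ hroots
  rw [hf.eval_eq x, hP0, eval_zero]

end PolyRep

/-! ### The building blocks of `R(n,x)` are polynomial in `x` -/

/-- `x ↦ fallProd m (f x)` for polynomial `f`. -/
def polyRep_fallProd (m : ℕ) {f : ℚ → ℚ} (hf : PolyRep f) : PolyRep fun x => fallProd m (f x) := by
  unfold fallProd
  exact PolyRep.prod (range m) fun i => hf.sub (PolyRep.const _)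

/-- `x ↦ bp m (f x)` for polynomial `f`. -/
def polyRep_bp (m : ℕ) {f : ℚ → ℚ} (hf : PolyRep f) : PolyRep fun x => bp m (f x) := by
  unfold bp
  exact (polyRep_fallProd m hf).divConst _

/-- `x ↦ T n (a − x) q` (`a, q` constants). -/
def polyRep_T (n : ℕ) (a q : ℚ) : PolyRep fun x => T n (a - x) q := by
  unfold T tT
  refine PolyRep.sum (range (n + 1)) fun j => ?_
  have h1 : PolyRep fun x => bp n (a - x - j) :=
    polyRep_bp n (((PolyRep.const a).sub PolyRep.id).sub (PolyRep.const _))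
  have h2 : PolyRep fun _ : ℚ => bp n (q - j) := PolyRep.const _
  exact (((PolyRep.const _).mul (PolyRep.const _)).mul h1).mul h2

/-- `x ↦ s(n, x + c, k)` (`c` a constant shift). -/
def polyRep_sR (n : ℕ) (c : ℚ) (k : ℕ) : PolyRep fun x => sR n (x + c) k := by
  have e : ∀ x, sR n (x + c) k =
      ((-1) ^ k * ((n.choose k : ℕ) : ℚ) * bp n ((3 * (n : ℚ) - c - k) - x))
        * T n ((3 * (n : ℚ) - c - k) - x) (qOf n k) := by
    intro x; unfold sR hR pOf; ring_nf
  have h1 : PolyRep fun x => bp n ((3 * (n : ℚ) - c - k) - x) :=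
    polyRep_bp n ((PolyRep.const _).sub PolyRep.id)
  have h := (((PolyRep.const ((-1 : ℚ) ^ k)).mul (PolyRep.const (((n.choose k : ℕ) : ℚ)))).mul h1).mul
    (polyRep_T n (3 * (n : ℚ) - c - k) (qOf n k))
  exact ⟨h.poly, fun x => by rw [e x]; exact h.eval_eq x⟩

/-- `x ↦ R(n, x + c)`. -/
def polyRep_Rsum (n : ℕ) (c : ℚ) : PolyRep fun x => Rsum n (x + c) := by
  unfold Rsum
  exact PolyRep.sum (range (n + 1)) fun k => polyRep_sR n c k

/-- `x ↦ η₀₀(w,x)`. -/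
def polyRep_eta00 (w : ℚ) : PolyRep fun x => eta00 w x := by
  refine ⟨X ^ 4 + C (1 - 6 * w) * X ^ 3 + C (12 * w ^ 2 - 6 * w) * X ^ 2 + C (12 * w ^ 2 - 8 * w ^ 3) * X
    + C (-8 * w ^ 3), fun x => ?_⟩
  simp only [eta00, eval_add, eval_mul, eval_pow, eval_C, eval_X]
  ring

/-- `x ↦ η₀₁(w,x)`. -/
def polyRep_eta01 (w : ℚ) : PolyRep fun x => eta01 w x := by
  refine ⟨C (-2) * X ^ 4 + C (14 * w - 4) * X ^ 3 + C (-35 * w ^ 2 + 23 * w - 3) * X ^ 2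
    + C (35 * w ^ 3 - 45 * w ^ 2 + 11 * w - 1) * X + C (-10 * w ^ 4 + 30 * w ^ 3 - 10 * w ^ 2 + 2 * w), fun x => ?_⟩
  simp only [eta01, eval_add, eval_mul, eval_pow, eval_C, eval_X]
  ring

/-- `x ↦ η₀₂(w,x)`. -/
def polyRep_eta02 (w : ℚ) : PolyRep fun x => eta02 w x := by
  refine ⟨X ^ 4 + C (3 - 8 * w) * X ^ 3 + C (24 * w ^ 2 - 18 * w + 3) * X ^ 2
    + C (-32 * w ^ 3 + 36 * w ^ 2 - 12 * w + 1) * X + C (16 * w ^ 4 - 24 * w ^ 3 + 12 * w ^ 2 - 2 * w), fun x => ?_⟩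
  simp only [eta02, eval_add, eval_mul, eval_pow, eval_C, eval_X]
  ring

/-- The (R-K2) combination as a polynomially represented function of `x`. -/
def polyRep_K2 (n : ℕ) :
    PolyRep fun x => eta00 n x * Rsum n x + eta01 n x * Rsum n (x + 1) + eta02 n x * Rsum n (x + 2) := by
  have h0 : PolyRep fun x => Rsum n x := by
    have h := polyRep_Rsum n 0
    exact ⟨h.poly, fun x => by rw [← add_zero x, h.eval_eq x, add_zero]⟩
  exact (((polyRep_eta00 n).mul h0).add ((polyRep_eta01 n).mul (polyRep_Rsum n 1))).add
    ((polyRep_eta02 n).mul (polyRep_Rsum n 2))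

/-! ### (R-K2) for every rational `k₃` -/

/-- **(R-K2), all `x`**: for `n ≥ 3` and EVERY rational `x` (in particular every integer `k₃`, including `k₃ = n`),
`η₀₀(n,x) R(n,x) + η₀₁(n,x) R(n,x+1) + η₀₂(n,x) R(n,x+2) = 0`. -/
theorem R_rel_K2_all (n : ℕ) (hn : 3 ≤ n) (x : ℚ) :
    eta00 n x * Rsum n x + eta01 n x * Rsum n (x + 1) + eta02 n x * Rsum n (x + 2) = 0 :=
  (polyRep_K2 n).eq_zero_of_lt (n : ℚ) (fun y hy => R_rel_K2 n hn y hy) x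

end VIMInner

end Summit.KontsevichZagierPeriods.Zeta5Search.Certificates
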